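import Mathlib
import HarnessLib
import HarnessLib.Audit
import Summits.KontsevichZagierPeriods.Statement

/-!
Route: AttractorUnfolding

DORMANT since 2026-09-04T21:45:35Z (reconciler: no traction for 5 d (last activity item-evidence-added at 2026-08-30T20:47:30Z); parked, not closed — `ledger route dormant route-KontsevichZagierPeriods-AttractorUnfolding --off` to react) — unstaffed, not closed; items shared with open routes are served there. `ledger route dormant <id> --off` reactivates.

# Route AttractorUnfolding — rank-two attractors — the Tate twist is a tube; fibrewise residues
unfold 2πi × elliptic periods inside the rules

It suffices to show X = ENGINE ∧ KERNEL (card rank-two-attractors-three-summits realised as a thin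
engine route whose rungs are the attractor
identities). ENGINE = FibrewiseCauchy ∧ FibrewiseResidue: along any ℚ-semialgebraic circle bundle
{|w − c(x)| = s(x)} over a semialgebraic base τ,
rationally parametrised by w = c + s(1+it)/(1−it), (E1) a fibrewise-holomorphic rational integrand
of bounded degree integrates to a RELATION, and
(E2) the Cauchy kernel a(x)·dw/(w − p(x)) with the pole inside is KZ-EQUIVALENT to the arctangent
carrier [τ × ℝ, −2·Im a(x)/(1+t²)] — the residue
theorem with parameters as a derived rule of KZ's rules 1)–3): this is the move that manufactures
the factor 2πi of a Tate twist H(−1) (tube /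
Leray coboundary over a divisor, cylinder map over a family of curves) without ever naming a
logarithm or an arctangent. KERNEL = ResidueKernel,
the kernel conjecture of the calculus enlarged by the E1/E2 relators (GPC-strength; modulo the
engine it is EQUIVALENT to
Literature.NumberTheory.Transcendental.KZKernelConjecture — said openly). KERNEL is REACHED
(route-choice repair 2026-08-16) through the π-LOCALISATION PAIR shared with route
AyoubSpecialisation and read here as the route's title: TwistLocalKernel (Conjecture 1 with the Tate
twist [π]⋆ inverted: eval c = 0 ⇒ ([π]⋆)^[N] c ∈ relations for some N) ∧ TwistCancellation ([π]⋆ is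
injective modulo moves) ⟹ the kernel form ⟹ ResidueKernel — glue item ResidueKernelGlue :
TwistProductRep → TwistCancellation → TwistLocalKernel → ResidueKernel, PROVED in the planner's
Sketch.lean — where [π]⋆ρ ≡ the arctangent carrier (tube) of ρ modulo moves (support TubeIsTwist: KZ
§1.1's chain π = ∬_disc = 2∫√(1−u²) = ∫du/√(1−u²) = ∫dt/(1+t²) with parameters) ≡ a fibrewise
contour integral (E2): 'the Tate twist is a tube'. The rungs the engine must deliver:
EllipticTubeUnfolding (typed: the
Tate twist H¹(E)(−1) ⊂ H²(𝔸² ∖ E) of a real elliptic arc, i.e. Im ∫_(tube) dx∧dy/(y² − f) ~ [arc ×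
ℝ, 1/(√f·(1+t²))]), then the card's attractor
block (informal items filed at open: AttractorCurveFamily = the generalised-Hodge-conjecture
instance predicting a surface fibred over the
conductor-54 curve inside Bönisch's fibre product X_z* = S₁ ×_ℙ¹ ε*S_z* of two Hesse pencils at z* =
−1/(2³3⁶); AttractorWeightTwoBlock = the
two explicit identities 2πi·ω_g⁺ = −(46·ΘΠ₁ + 48·ΘΠ₃)(z*)/384, 2πi·ω_g⁻ = −(3·ΘΠ₂ + 8·ΘΠ₄)(z*)/32 as
typed pairs, value-equality NUMERICAL).
Lean:
`Summit.KontsevichZagierPeriods.KontsevichZagierPeriods.Theses.AttractorUnfolding.FibrewiseCauchy ∧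
Summit.KontsevichZagierPeriods.KontsevichZagierPeriods.Theses.AttractorUnfolding.FibrewiseResidue ∧
Summit.KontsevichZagierPeriods.KontsevichZagierPeriods.Theses.AttractorUnfolding.ResidueKernel`

## Assembly
Pure algebra, PROVED in the folder's Sketch.lean / SketchFQ.lean (rc 0, 0 sorries) and supplied as
glue.lean: from ResidueKernel, ker eval ≤
KZ.relations ⊔ closure(E1 ∪ E2 relators); the relator sets repeat the hypotheses of FibrewiseCauchy
/ FibrewiseResidue verbatim, so `sup_le le_rfl
(closure_le …)` with the two engine hypotheses gives ker eval ≤ relations and the summit follows as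
in
Theorems/KernelFormKernelImpliesStatement.lean. EllipticTubeUnfolding, PointResidue and the informal
attractor items are rungs, not hypotheses of
`closes`.

Rationale: WHY THIS LINE. At a rank-two attractor z* of a one-parameter Calabi–Yau pencil over ℚ, H³ splits
Hodge-compatibly as Λ ⊕ Λ⊥ with Λ⊥ of level one, and three
summits make the same prediction about one explicit 4×4 period matrix: Galois (persistent
factorisations, ρ ≃ ρ_f ⊕ ρ_g(−1), f ∈ S₄(Γ₀(54)), g ∈
S₂(Γ₀(54)); arXiv:1912.06146, arXiv:2203.09426 §3.3, Bönisch's Bonn thesis 2023 §5.1 = lit key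
paper:galaxy-pdf-4515400434874597500), Hodge (the
splitting projector / GHC: Λ⊥ is carried by a surface fibred in curves over E_g — Clemens–Griffiths
doi:10.2307/1970801 and Griffiths1969 are the
model), and Kontsevich–Zagier (the numerically established identities "projection of Π′(z*) on (2,1)
= ℚ-combinations of 2πi·ω_g^±", BKSZ p. 19,
Bönisch p. 110 with explicit rational A, B). Imported areas: arithmetic of Calabi–Yau motives and
modularity (the PREDICTION), Hodge theory of
normal functions / cylinder maps (the SHAPE of the chain), residue calculus made semialgebraic (the
MOVE). What no prior route does: CyclesAsDomains
and MotivatedMoves integrate over GIVEN cycles on products and both list "the residue lemma (tube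
terms ↦ 2π × residue representations)" as not yet
decomposed; MultivaluedCoV transfers along correspondences already in hand; GammaCornerAnomaly
treats the MUM/conifold constants (weight-4 / Γ side)
of the same fourteen pencils; here the object is the smooth attractor fibre's weight-2 block, the
cycle is PREDICTED by arithmetic, and the engine
(E1/E2) is the typed residue-with-parameters rule those routes name but do not file. Negatives index
(`ledger negatives`, 2026-08-15): exactly one
refuted statement on this summit (KinematicPlaneConvex, stmt-5394, convex-geometry hypotheses) —
unrelated to every item here.

RANKED CRUXES. #0 ResidueKernel (target) — kernel conjecture of the calculus enlarged by the
fibrewise Cauchy (E1) and residue (E2) relators: every formal ℤ-combination of integral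
representations with value 0 lies in KZ.relations ⊔ closure(E1-relators ∪ E2-relators). Honest
status: modulo FibrewiseCauchy ∧ FibrewiseResidue it is equivalent to
Literature.NumberTheory.Transcendental.KZKernelConjecture; filed so that the engine is load-bearing
in `closes`. REACHED since the route-choice repair of 2026-08-16 by the glue item ResidueKernelGlue
: TwistProductRep → TwistCancellation → TwistLocalKernel → ResidueKernel (PROVED in the planner's
Sketch.lean, rc 0): the π-localisation pair shared with route AyoubSpecialisation (items 0540 /
0541), read here as the route's title — the Tate twist [π]⋆ is a tube (support TubeIsTwist) and a
tube is a contour integral (E2). (why it might fail: GPC-strength: false iff some equal-valued pair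
is underivable even with residues as a rule (route Neg's bets: Gauss-triplication pair
stmt-0311/0312, regularised MZV relations); the strength barriers bite here and only here.)
[KontsevichZagier2001, HuberMullerStach2017, Ayoub2015, CressonViusos2022]
#3 FibrewiseResidue (crux) — (E2, the 2πi-carrier; card K2's fibrewise "Cauchy move") over a
ℚ-semialgebraic base τ ⊂ ℝⁿ with semialgebraic centre c(x) ∈ ℂ, radius s(x) > |p(x) − c(x)|, pole
p(x) and complex coefficient a(x): the (n+1)-dimensional representation [τ × ℝ, Re(a·w′(t)/(w(t) −
p))], w = c + s(1+it)/(1−it), w′ = 2is/(1−it)², is KZ-equivalent to [τ × ℝ, −2·Im a(x)/(1+t²)]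
(value ∫_τ Re(2πi·a) = −2π∫_τ Im a; checked numerically, folder num/residue_check.py). Suggested
chain: CAD of τ × ℝ; Re(w′/(w−p)) = ∂_t log|w−p| and Im(w′/(w−p)) = ∂_t arg(w−p) are handled WITHOUT
primitives by the substitutions u = |w−p|² resp. u = Im(w−p)/Re(w−p) on monotonicity cells (rule 2)
— the signed image cells cancel (log part) or cover ℝ_u exactly twice (arg part, pole inside), so
domain additivity alone finishes: a winding-number instance of LinkTwistWrithe's DegreeTransfer with
parameters. [difficulty: L] (why it might fail: uniformity in x needs a ℚ-CAD with continuous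
semialgebraic sections (not in tree) for the monotonicity cells of |w−p|² and arg(w−p); the signed
cancellation is bookkept cell by cell in the free abelian group — one mistyped side condition
(Re(w−p)=0 walls) falsifies the ∀.) [KontsevichZagier2001, BochnakCosteRoy1998, BasuPollackRoy2006,
HuberMullerStach2017]
#4 FibrewiseCauchy (crux) — (E1, Cauchy's theorem with parameters) same circle bundle; g(x, ·) a
semialgebraic family of rational functions of degree ≤ N holomorphic on the closed fibre discs (g =
A/B fibrewise, B zero-free on |w − c(x)| ≤ s(x)); then [τ × ℝ, Re(g(x, w(t))·w′(t))] ∈ KZ.relations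
(value 0). Suggested chain: fibrewise partial fractions over the CAD cells where the poles p_j(x)
(all OUTSIDE the closed disc) are continuous semialgebraic branches (rule 1b); polynomial part and
poles of order ≥ 2 have ALGEBRAIC primitives along t (rule 3 on the compactified band, rule 2 t =
u/(1−u²)); simple poles outside = the winding-zero case of FibrewiseResidue's chain. [deps:
FibrewiseResidue] [difficulty: L] (why it might fail: the root functions p_j(x) of B(x,·) are
semialgebraic only cellwise and collide on walls (multiplicity jumps): partial fractions are not
uniformly integrable near a wall where two outside poles merge, forcing a refinement whose
finiteness/integrability must be re-proved; degree bound N is essential.) [KontsevichZagier2001,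
BochnakCosteRoy1998, BasuPollackRoy2006]
#5 EllipticTubeUnfolding (crux) — (calibration rung = the Tate twist of an elliptic arc, card K2 one
dimension down) f = X³ + aX + b over ℚ, f > 0 on [u₁,u₂], upper arc P(x) = (x, √f(x)), complex
normal lines L_x = {P(x) + μ(−f′(x), 2√f(x))}, ε ∈ ℚ_>0 below the other intersections of L_x with
{y² = f}: the 2-dim tube representation [(u₁,u₂) × ℝ, Im(J·μ′/(Y² − f(X)))] (μ = ε(1+it)/(1−it),
(X,Y) = P + μ·n, J the Jacobian of (x,μ) ↦ (X,Y)) is KZ-equivalent to [(u₁,u₂) × ℝ,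
1/(√f(x)(1+t²))]; both have value π∫dx/√f (residue of dx∧dy/(y²−f) is dx/2y; checked to 1e−6 at a =
−1, b = 0, [−0.9,−0.1], ε = 1/100, folder num/tube_check.py). This is H¹(E)(−1) → H²(𝔸² ∖ E) (tube
map) as a chain; one dimension up it is the weight-2 block. [deps: FibrewiseCauchy,
FibrewiseResidue] [difficulty: M] (why it might fail: after partial fractions in μ (denominator
μ·Q(x,μ), Q quadratic) the two outside roots of Q(x,·) are algebraic in x and may switch
real/complex inside [u₁,u₂] — a wall the statement does not display, forcing an undisplayed base
split; a sign slip falsifies exactly (value check passed).) [KontsevichZagier2001, Griffiths1969,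
GriffithsHarris1978, doi:10.2307/1970801]
#6 TwistCancellation (crux; ONE item shared with AyoubSpecialisation 0540 `AyoubPiCancellation`,
signature verbatim) — twist injectivity / π-cancellation: for every pinned product P (P n r = [π] ⋆
r, closed unit disc in the two leading coordinates) and every formal combination c, [π] ⋆ c ∈
KZ.relations → c ∈ KZ.relations; transcendence-free (constrains no value), implied by the kernel
conjecture (KZProduct `piCancellation_of_kernel`); on this route it says that an identity certified
inside a contour/residue presentation (after tubing, where E1/E2 act) descends to the untubed
identity. [deps: TwistProductRep] [difficulty: open-problem] (why it might fail: a certificate for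
[π]⋆c may mix the two disc coordinates with c's own by changes of variables, leaving no shadow
certificate for c; the motivic analogue — effective → 2πi-localised formal periods injective — is
open in print, HuberWustholz2022 App. A.4; one witness (AyoubSpecialisation 0542) refutes the
summit.) [HuberWustholz2022, KontsevichZagier2001, HuberMullerStachPeriods2017, AyoubRelKZRevisited,
Ayoub2014]
#7 TwistLocalKernel (crux; shared with AyoubSpecialisation 0541 `AyoubPiLocalKernel`, signature
verbatim) — Conjecture 1 with the twist inverted: eval c = 0 ⇒ ∃ N, ([π]⋆)^[N] c ∈ KZ.relations —
Conjecture 1 for the effective period ring localised at [π] (KontsevichZagier2001 §4.1, Ayoub2014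
Conj. 7, HuberMullerStachPeriods2017 Conj. 13.2.1), the form every structural argument in print
addresses; here: every vanishing combination is derivable after finitely many tubings, i.e. inside
contour presentations where the residue theorem with parameters is a derived rule; (I±) and
EllipticTubeUnfolding are once-twisted instances. CONJECTURE-GRADE, said openly (with #6 it is the
kernel form, hence the summit); ranked last because its splits belong to the torsor routes
(Grothendieck / VeryGoodTransfer), not here. [deps: TwistProductRep] [difficulty: open-problem] (why
it might fail: period-conjecture strength once #6 holds — Ayoub2014 Cor. 32, HMS Prop. 13.2.6 give
algebraic independence of odd zeta values; torsor methods yield relations in Nori's presentation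
only and their transfer into the four moves, even with [π] inverted, is unproved.) [Ayoub2014,
HuberMullerStachPeriods2017, KontsevichZagier2001, arXiv:1105.0865, AyoubRelKZRevisited]
#9 TwistProductRep (support; shared with AyoubSpecialisation 10941 `PiProductRep`) — the pinned
product P n r = [π] ⋆ r : IntegralRep (n+2) exists (transport of
`Literature.NumberTheory.Transcendental.KZ.piRep.prod r` along Fin (2+n) ≃ Fin (n+2)); makes the
∀-pinned-P items non-vacuous; first hypothesis of the glue. [difficulty: provable-now]
[KontsevichZagier2001]
#9 ResidueKernelGlue (support; the glue that concludes the target) — TwistProductRep →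
TwistCancellation → TwistLocalKernel → ResidueKernel; PROVED in the planner's Sketch.lean (12 tactic
lines: peel one [π] at a time along left-nested iterates, then `AddSubgroup.mem_sup_left`), to be
landed in Theorems/ by any prover. [difficulty: provable-now] [KontsevichZagier2001, Ayoub2014]
#9 TubeIsTwist (support; the title as a dictionary item) — for every pinned P, every ρ : IntegralRep
n and every r' : IntegralRep (n+1) with domain {init z ∈ ρ.domain} and integrand ρ(init z)/(1 +
z_last²) (the arctangent carrier of E2 / of the tube rung over ρ): [r'] − [P n ρ] ∈ KZ.relations
(values π·value ρ). Chain = KZ §1.1's π = ∬_disc = 2∫√(1−u²) = ∫du/√(1−u²) = ∫dt/(1+t²) with the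
parameter x carried along: rule 2 (t = u/√(1−u²)), rules 3 + 1b (primitive ρ(x)·u√(1−u²), vanishing
at u = ±1), rule 3 along a new last coordinate y (primitive y·ρ(x); disc trailing), the proved
coordinate-permutation relation
`Literature.NumberTheory.Transcendental.KZ.of_sub_of_reindex_mem_relations` (disc leading), null
boundary adjustments by domain additivity. With FibrewiseResidue: [τ × ℝ, Re(a·w′/(w − p))] ≡ [π] ⋆
[τ, −2·Im a] — the residue theorem with parameters as a [π]-multiple. [deps: TwistProductRep,
FibrewiseResidue] [difficulty: M] [KontsevichZagier2001, HuberMullerStachPeriods2017]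
#9 PointResidue (support) — the n = 0 case of FibrewiseResidue with algebraic constants c, p, a, s
(|p − c| < s): [ℝ, Re(a·w′/(w − p))] ~ [ℝ, −2·Im a/(1+t²)] — "∮dw/(w−p) = 2πi inside the rules", the
first residue derivation in the tree; provable now by the two substitutions of FibrewiseResidue
without parameters. [difficulty: provable-now] [KontsevichZagier2001]

TWO-LAYER PLAN. Filed informally at open (no varieties / algebraic-cycles API in Mathlib; signatures
to be set by a grounder once the cycles are written as
semialgebraic domains): AttractorCurveFamily (crux, rank 2 — the FIRST and load-bearing statement of
the card, filed informally: a surface Z ⊂ X_z* ×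
E_g, X_z* = S₁ ×_ℙ¹ ε*S_z* Bönisch's fibre product of Hesse pencils sXYZ = t(X³+Y³+zZ³), whose
cylinder map H₁(E_g) → H₃(X_z*) spans Λ⊥^∨;
GHC instance, unproved), AttractorWeightTwoBlock (crux, rank 6: the identities (I±) as typed pairs
over the thimble-join 3-cycles of the
fibre product; value-equality numerical, ten digits), NormalFunctionUnfolding (support: for a
surface π : Z → B fibred in curves inside a
threefold and a pole-order-2 ambient form, tube ∘ cylinder = E2 twice + E1 + Newton–Leibniz with an
algebraic primitive on B). Foreseen
glued splits (k ≤ 3, depth 1), only after a crux closes: FibrewiseResidue ⇐ LogPartCancels →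
ArgPartCovers → FibrewiseResidue;
EllipticTubeUnfolding ⇐ TubePartialFractions → EllipticTubeUnfolding (with E1, E2). The TARGET's
decomposition is filed flat since the 2026-08-16 route-choice repair (ResidueKernel ⇐
TwistProductRep → TwistCancellation → TwistLocalKernel, glue ResidueKernelGlue, k = 3, depth 1); the
two twist cruxes are NOT split inside this route — AyoubSpecialisation's two-layer plan owns them
(TwistCancellation ⇐ RelationsIdeal → FibreSpecialisation; TwistLocalKernel ⇐ torsor injectivity
with [π] inverted → transfer of cohomological relators), and this route's contribution to them is
the residue presentation of [π]⋆ (TubeIsTwist + E2).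

KILL CRITERIA. An additive invariant FormalRep →+ A vanishing on the four move sets (shape
Neg.NegObstructionShape) separating the two sides of PointResidue or
EllipticTubeUnfolding refutes that crux AND the summit (values certified equal) — close
`refuted:<Decl>`, hand the witness to route Neg / the
operator. FibrewiseResidue or FibrewiseCauchy refuted AS TYPED (a side condition) ⇒ restate
(misstated), not abandon; refuted substantively
(a genuinely underivable parametric residue) ⇒ the card's mechanism is dead: close
`refuted:FibrewiseResidue`. AttractorWeightTwoBlock:
a certified 300-digit recomputation contradicting (I±) beyond the isogeny/Manin scaling kills the
instance (not the engine). If BGK's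
"fibering out" or a Kuga–Sato-type correspondence PROVES the 54-splitting, AttractorCurveFamily
becomes known and the route keeps only the
chain items. ResidueKernel refuted = kernel conjecture refuted (all positive routes close).
TwistCancellation refuted (a π-division witness: [π]⋆c ∈ relations, c ∉ relations —
AyoubSpecialisation's support 0542) or TwistLocalKernel refuted ⇒ with soundness the kernel
conjecture and the summit are refuted; the engine items (E1, E2, PointResidue, TubeIsTwist) survive
as derived rules and the route closes `refuted:<Decl>` together with every positive route.

NOT DECOMPOSED YET. Semialgebraic descriptions of the four integral 3-cycles of X_z* (torus γ₁ is
immediate: Π₁ = (2πi)³Σ((3n)!/n!³)²zⁿ is a 4-torus integral of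
1/(1 − z·(X+Y+1)³(Z+W+1)³/(XYZW)); γ₂…γ₄ are thimble joins α_t × β_t swept between singular fibres t
∈ {3ξ} ∪ {z^(1/3)/(3ξ)} of the two
Hesse pencils) — layer-2 children of AttractorWeightTwoBlock; the search space for
AttractorCurveFamily (multisection pull-backs C ×_ℙ¹ ε*S_z*,
graphs of fibrewise isogenies at z*, C₃-quotient geometry); the second attractor (indices
1/4,1/3,2/3,3/4 at z* = −1/(2⁴3³), g = the CM form of
level 32, i.e. y² = x³ − x: ω_g^± are lemniscatic, so the weight-2 block there is a Γ(1/4)²·√π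
identity — deliberately deferred until the 54 case
is typed, because z* lies OUTSIDE the MUM disc there and needs continuation); any use of limits ε →
0 (tubes stay at fixed rational radius);
the converse 'chain ⇒ motivic relation' (card P2, sharpened by the triage refuter: one chain gives
ONE relation in the formal period algebra,
not an isomorphism of motives) — recorded, not filed. Item budget after the repair: 14/15; a tenure
planner who needs room for the foreseen splits drops an informal placeholder
(AttractorWeightTwoBlock or NormalFunctionUnfolding) first. Also not filed: the contour-native forms
of the twist cruxes (π-cancellation / π-local kernel stated over E2's circle bundles instead of the
pinned disc product) — they are move-equivalent to #6/#7 by TubeIsTwist and would only duplicate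
shared items.

CHEAPEST FALSIFIER. (i) Value checks are done (num/*.py: E2 four configurations incl. a pole at
0.99·s; tube rung to 1e−6), so numerics cannot kill the typed items;
the cheapest structural check a refuter should run first: write the n = 0 chain of PointResidue by
hand for c = 0, s = 1, p = 1/2, a = 1 —
u = |w − p|² has exactly two monotonicity cells on ℝ_t and u = Im/Re(w − p) has three; if the signed
images do not cancel / double-cover as
claimed, FibrewiseResidue's suggested chain is wrong (the statement may survive via DegreeTransfer).
(ii) For the card: recompute (I±) to 300 digits with
an independent Frobenius basis and PSLQ against {2πiω^±, 2πiη^±} of BOTH curves 54a/54b (kit job not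
submitted from this seat: hub compute-free,
instance item informal) — a mismatch beyond isogeny scaling retypes AttractorWeightTwoBlock. (iii)
Lookup run: Bönisch's thesis §5.1 and BKSZ §4
contain NO cycle / correspondence for the 54-splitting (read pp. 90–110 resp. 21–23: modularity of
Galois reps proved only in thesis §§5.2, 5.4;
period identities numerical) — so AttractorCurveFamily is genuinely open, not known. (iv) For the
twist cruxes #6/#7 (shared): AyoubSpecialisation's falsifier applies verbatim — take an identity
classically proved by multiplying by π and dividing back (Euler's ζ(2) against [π]⋆[π], Legendre's
relation with right side π/2) and test whether an in-tree additive move invariant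
(`Literature.Barriers.KontsevichZagierPeriods.not_kz_of_moveInvariant_separating` machinery)
separates c from relations while [π]⋆c has an explicit certificate; on this route the same test
reads 'an identity certified through a contour presentation (E1/E2) that no untubed chain reaches' —
one such c kills #6 and the summit.

NUMBERS. z* = −1/5832 = −1/(2³3⁶) (inside the MUM disc |z| < 3⁻⁶, ratio 1/8); L = θ⁴ −
3⁶z(θ+1/3)²(θ+2/3)²; Bönisch's basis Π = M·ϖ, M =
diag((2πi)³,(2πi)²,2πi,1) + (−16ζ(3)) at (4,1), ϖ the Frobenius basis in log(−z); T(z*) = (Π, ΘΠ,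
Θ²Π, Θ³Π)(z*) = A·blockdiag((ω_f,η_f),
2πi(ω_g,η_g))·B with A = [[0,−48,−48,0],[8,0,0,−24],[0,46,−18,0],[−3,0,0,−23]], B =
[[27/4,−9/8,1/8,21/8],[0,0,0,−1/3888],[0,1/8,1/8,−7/162],
[0,0,−1/216,5/3888]] (thesis p. 110); ω_g⁺ = 1.052362238, ω_g⁻ = 0.8924581010 i, η_g⁺ = 32.63160583,
η_g⁻ = 33.64385855 i, ω_g⁺η_g⁻ − ω_g⁻η_g⁺ =
2πi; planner's elimination: (I+) 2πi·ω_g⁺ = −(46·ΘΠ₁ + 48·ΘΠ₃)(z*)/384 (check: −(46·1.422681792 +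
48·(−54.26089900))/3072 = 0.8265234 =
2π·1.052362238/8 ✓), (I−) 2πi·ω_g⁻ = −(3·ΘΠ₂ + 8·ΘΠ₄)(z*)/32 (check 0.7009350 both sides ✓), and the
Λ⊥-orthogonality 46·Π₁(z*) + 48·Π₃(z*) = 0
(11342.44 − 11342.44 ✓). BKSZ normalisation (periodI): same block with A =
[[0,486,6,12],[−108,−1620,−4,−4],[0,−162,2,0],[27,−81,1,1]], A⁻¹ rows
3,4 = (0,−1/24,1/2,−1/6), (1/12,1/24,−1/4,1/6). Tube rung test values: a = −1, b = 0, [u₁,u₂] =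
[−9/10,−1/10], ε = 1/100: Im r = 4.806639 = r′,
min |F|/|μ| on the punctured disc = 1.33 > 0. Items at open: 6 typed (3 cruxes, target, assembly, 1
support) + 3 informal; after the 2026-08-16 route-choice repair: 14 = target + assembly + 6 cruxes
(FibrewiseResidue, FibrewiseCauchy, EllipticTubeUnfolding, TwistCancellation, TwistLocalKernel
typed; AttractorCurveFamily informal) + 6 supports (PointResidue, TwistProductRep,
ResidueKernelGlue, TubeIsTwist typed; AttractorWeightTwoBlock, NormalFunctionUnfolding informal).
Glue proof: Sketch.lean rc 0, 0 sorries, axioms propext / Classical.choice / Quot.sound.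

DEFINITION REQUESTS. None for the typed items (KZCalculus + Mathlib only; cone = the Statement's
own). Wanted later (not filed now): `KZ.familyRep` / semialgebraic
3-cycle presentations of fibre-product Calabi–Yau threefolds (topic
Summits/KontsevichZagierPeriods/KontsevichZagierPeriods/Theorems) for
AttractorWeightTwoBlock; cite-fact candidates: none needed as hypotheses (the modularity of the
54-splitting is NOT used by any item).

Novelty: Searches (2026-08-15): `lit galaxy search "rank two attractor" --star all` (2 pdf hits: Lukas–Ruehle
JHEP 2023 flops — irrelevant; Bönisch's
Bonn dissertation 2023 — READ pp. 1–2, 32, 90–110: explicit fibre-product model, A, B, ten-digit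
numerics, Hodge/Tate framing, no cycle, no
rules reading); `lit read arXiv:2203.09426` pp. 5–6, 8, 19–23 (conventions, §3.3 verbatim, §4 =
modular parametrisation proof of the WEIGHT-4
block at the X₂₂₂₂ conifold, transcendental); `lit search "rank two attractor Calabi-Yau …
correspondence"` (searchd rc 75 this hour — not
run; the card's own crossref/zbMATH searches of 16:27Z stand); tree greps of all 80 Theses for
tube/Leray/winding/residue (hits only as
"not decomposed yet" in CyclesAsDomains, MotivatedMoves; DegreeTransfer in
LinkTwistWrithe/CobordismMove is the nearest typed engine).
Nearest prior art found: paper:galaxy-pdf-4515400434874597500 (Bönisch 2023, §5.1) and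
arXiv:2203.09426 §3.3 (the identities, numerically;
motivic framing); arXiv:1912.06146 (the phenomenon); doi:10.2307/1970801 + Griffiths1969 (cylinder
maps / normal functions, the geometric
model); in-tree stmt-KontsevichZagierPeriods-4306 DegreeTransfer (winding as signed sheet transfer,
no complex structure, no parameters).
Delta: reads the attractor weight-2 identities as Conjecture-1 instances whose chain SHAPE is
dictated by the predicted cycle (tube ∘ cylinder
over an elliptic family of curves) and files the missing typed rule — the residue theorem with
semialgebraic  [refs: 10.2307/1970801, 2203.09426, 1912.06146, paper:galaxy-pdf-4515400434874597500, doi:10.2307/1970801, Griffiths1969]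

Barriers (technique_class: normal-function-unfolding, fibrewise-residue): - technique_class: normal-function-unfolding, fibrewise-residue
- Literature.Barriers.KontsevichZagierPeriods.noSemialgebraicPrimitive_inv_sub_two: evaded — no item
integrates 1/(w−p) out: the log- and arg-parts of dw/(w−p) are moved by SUBSTITUTIONS u = |w−p|², u
= Im/Re(w−p) on monotonicity cells and cancelled/double-counted by domain additivity; the only
rule-3 primitives foreseen are algebraic (polynomial parts, poles of order ≥ 2).
- Literature.Barriers.KontsevichZagierPeriods.cressonViuSos_prop_3_2: respected — every change of
variables acts cellwise after a CAD (scissors kept), in fibre dimension 1 where the Hauptvermutung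
hypothesis is vacuous.
- Literature.Barriers.KontsevichZagierPeriods.kzConjecture_implies_ellipticPeriods_algIndep: not
engaged by the cruxes (they assert specific linear identities between CY periods and 2πi·ω_g, never
independence; E_g of conductor 54 is non-CM, and nothing here constrains trdeg(ω,η,π)); it bites
only the target ResidueKernel (GPC-strength, said openly), as do
kzConjecture_implies_oddZetaAlgIndep and kzConjecture_implies_twoPiI_log_algIndep.
- Literature.Barriers.KontsevichZagierPeriods.not_complete_of_undecidable: consistent — explicit
finite chains for explicitly equal values; conditional barrier (premise open) touching only the
target.
- Negatives index: checked `ledger negatives --problem KontsevichZagierPeriods` (2026-08-15): 1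
refuted statement, KinematicPlaneConvex (stmt-5394, by KinematicFormulasKinematicPlaneConvex_refuted

Novelty grade: new-combination — ROUTE-REVIEW grade (refuter-rreview-0815T17-0-0, 2026-08-15; searchd rc75 at 18:09Z and 18:11Z, so graded on the planner's documented searches + my tree check of all 80 KZ Theses + galaxy substring/bm25 probes): new-combination = (A) the arithmetic rank-two-attractor prediction (BKSZ/Bönisch numeric (refuter refuter-rreview-0815T17-0-0, 2026-08-15T18:10:25Z; prior: arXiv:2203.09426 (BKSZ §3.3: the weight-2 identities at z*=-1/5832, numerical), paper:galaxy-pdf-4515400434874597500 (Bönisch, Bonn thesis 2023 §5.1: fibre-product model, matrices A,B), arXiv:1912.06146 (rank-two attractor phenomenon), doi:10.2307/1970801 (Clemens–Griffiths: cylinder map / level-one H^3), Griffiths1969 (periods of integrals, pole-order filtration, normal functions), Ayoub2015 Rem.)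

History (route lifecycle, newest last):
- 2026-08-16T02:19:04Z · AUTO-CRUX: 1 conjecture-grade item(s) promoted to crux (ResidueKernel) — refuter vetting / tiering apply (operator:999:1362873)
- 2026-08-16T04:07:36Z · AUTO-CRUX (backfill): ResidueKernel — hypotheses of the deciding theorem that nothing in the route derives are cruxes (operator:999:1085951)
- 2026-08-24T04:04:25Z · DORMANT — reconciler: no traction for 6.5 d (last activity item-evidence-added at 2026-08-17T14:59:28Z); parked, not closed — `ledger route dormant route-KontsevichZagier (operator:999:3896866)
- 2026-08-30T03:32:59Z · REACTIVATED — reconciler: reactivated — activity statement-attached at 2026-08-30T02:51:58Z after parking at 2026-08-24T04:04:25Z (operator:999:3780872)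
- 2026-09-04T21:45:35Z · DORMANT — reconciler: no traction for 5 d (last activity item-evidence-added at 2026-08-30T20:47:30Z); parked, not closed — `ledger route dormant route-KontsevichZagierPe (operator:999:4160226)

sub-problem: KontsevichZagierPeriods · status: dormant · opened planner-plancard-KontsevichZagierPeriods-Kont-5b6440c9-0 2026-08-15T17:26:14Z · rev 3 · ledger route-KontsevichZagierPeriods-AttractorUnfolding
GENERATED by the gate from the ledger (D-0016/17). Provers cite these decls: `theorem foo : Summit.KontsevichZagierPeriods.KontsevichZagierPeriods.Theses.AttractorUnfolding.<Decl> := …` in Summits/KontsevichZagierPeriods/KontsevichZagierPeriods/Theorems/<Name>.lean.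
-/

namespace Summit.KontsevichZagierPeriods.KontsevichZagierPeriods.Theses.AttractorUnfolding

open scoped BigOperators Topology Manifold Classical MeasureTheory ProbabilityTheory Matrix InnerProductSpace ComplexConjugate ContinuousMap
open Filter Set Function TopologicalSpace MeasureTheory

attribute [summit_statement] _root_.KontsevichZagierPeriods

open Literature Periods

/-- item stmt-KontsevichZagierPeriods-11360 · crux (kind.auto-crux: conjecture-grade) · rank 0 · open · by planner
why it might fail: GPC-strength: false iff some equal-valued pair is underivable even with residues as a rule (route Neg's bets: Gauss-triplication pair stmt-0311/0312, regularised MZV relations); the strength barriers bite here and only here.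
sources: KontsevichZagier2001, HuberMullerStach2017, Ayoub2015, CressonViusos2022
[target] kernel conjecture of the calculus enlarged by the fibrewise Cauchy (E1) and residue (E2)
relators: every formal ℤ-combination of integral representations with value 0 lies in KZ.relations ⊔
closure(E1-relators ∪ E2-relators). Honest status: modulo FibrewiseCauchy ∧ FibrewiseResidue it is
equivalent to Literature.NumberTheory.Transcendental.KZKernelConjecture; filed so that the engine is
load-bearing in `closes`. -/
@[route_item "route-KontsevichZagierPeriods-AttractorUnfolding"]
def ResidueKernel : Prop :=
  ∀ d : Literature.NumberTheory.Transcendental.KZ.FormalRep, Literature.NumberTheory.Transcendental.KZ.eval d = 0 → d ∈ Literature.NumberTheory.Transcendental.KZ.relations ⊔ AddSubgroup.closure ({d : Literature.NumberTheory.Transcendental.KZ.FormalRep | ∃ (n N : ℕ) (τ : Set (Fin n → ℝ)) (c : (Fin n → ℝ) → ℂ) (s : (Fin n → ℝ) → ℝ) (g : (Fin n → ℝ) → ℂ → ℂ) (r : Literature.NumberTheory.Transcendental.KZ.IntegralRep (n + 1)), Literature.ModelTheory.ExponentialFields.IsSemialgebraic ℚ τ ∧ Literature.NumberTheory.Transcendental.IsSemialgebraicFunOn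 ℚ τ (fun x => (c x).re) ∧ Literature.NumberTheory.Transcendental.IsSemialgebraicFunOn ℚ τ (fun x => (c x).im) ∧ Literature.NumberTheory.Transcendental.IsSemialgebraicFunOn ℚ τ s ∧ (∀ x ∈ τ, 0 < s x) ∧ Literature.NumberTheory.Transcendental.IsSemialgebraicFunOn ℚ {p : Fin (n + 2) → ℝ | (Fin.init (Fin.init p) : Fin n → ℝ) ∈ τ ∧ ‖((Fin.init p (Fin.last n) : ℝ) : ℂ) + (p (Fin.last (n + 1)) : ℂ) * Complex.I - c (Fin.init (Fin.init p))‖ ≤ s (Fin.init (Fin.init p))} (fun p => (g (Fin.init (Fin.init p)) ((Fin.init p (Fin.last n) : ℂ) + (p (Fin.last (n + 1)) : ℂ) * Complex.I)).re) ∧ Literature.NumberTheory.Transcendental.IsSemialgebraicFunOn ℚ {p : Fin (n + 2) → ℝ | (Fin.init (Fin.init p) : Fin n → ℝ) ∈ τ ∧ ‖((Fin.init p (Fin.last n) : ℝ) : ℂ) + (p (Fin.last (n + 1)) : ℂ) * Complex.I - c (Fin.init (Fin.init p))‖ ≤ s (Fin.init (Fin.init p))} (fun p => (g (Fin.init (Fin.init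 p)) ((Fin.init p (Fin.last n) : ℂ) + (p (Fin.last (n + 1)) : ℂ) * Complex.I)).im) ∧ (∀ x ∈ τ, ∃ A B : Polynomial ℂ, A.natDegree ≤ N ∧ B.natDegree ≤ N ∧ ∀ w : ℂ, ‖w - c x‖ ≤ s x → B.eval w ≠ 0 ∧ g x w = A.eval w / B.eval w) ∧ r.domain = {z | (Fin.init z : Fin n → ℝ) ∈ τ} ∧ Set.EqOn r.integrand (fun z => (g (Fin.init z) (c (Fin.init z) + (s (Fin.init z) : ℂ) * (1 + (z (Fin.last n) : ℂ) * Complex.I) / (1 - (z (Fin.last n) : ℂ) * Complex.I)) * (2 * Complex.I * (s (Fin.init z) : ℂ) / (1 - (z (Fin.last n) : ℂ) * Complex.I) ^ 2)).re) r.domain ∧ d = Literature.NumberTheory.Transcendental.KZ.of r} ∪ {d : Literature.NumberTheory.Transcendental.KZ.FormalRep | ∃ (n : ℕ) (τ : Set (Fin n → ℝ)) (c p a : (Fin n → ℝ) → ℂ) (s : (Fin n → ℝ) → ℝ) (r r' : Literature.NumberTheory.Transcendental.KZ.IntegralRep (n + 1)), Literature.ModelTheory.ExponentialFields.IsSemialgebraic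 ℚ τ ∧ Literature.NumberTheory.Transcendental.IsSemialgebraicFunOn ℚ τ (fun x => (c x).re) ∧ Literature.NumberTheory.Transcendental.IsSemialgebraicFunOn ℚ τ (fun x => (c x).im) ∧ Literature.NumberTheory.Transcendental.IsSemialgebraicFunOn ℚ τ (fun x => (p x).re) ∧ Literature.NumberTheory.Transcendental.IsSemialgebraicFunOn ℚ τ (fun x => (p x).im) ∧ Literature.NumberTheory.Transcendental.IsSemialgebraicFunOn ℚ τ (fun x => (a x).re) ∧ Literature.NumberTheory.Transcendental.IsSemialgebraicFunOn ℚ τ (fun x => (a x).im) ∧ Literature.NumberTheory.Transcendental.IsSemialgebraicFunOn ℚ τ s ∧ (∀ x ∈ τ, ‖p x - c x‖ < s x) ∧ r.domain = {z | (Fin.init z : Fin n → ℝ) ∈ τ} ∧ r'.domain = {z | (Fin.init z : Fin n → ℝ) ∈ τ} ∧ Set.EqOn r.integrand (fun z => (a (Fin.init z) * (2 * Complex.I * (s (Fin.init z) : ℂ) / (1 - (z (Fin.last n) : ℂ) * Complex.I) ^ 2) / ((c (Fin.init z) + (s (Fin.init z) : ℂ) * (1 + (z (Fin.last n) : ℂ)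 * Complex.I) / (1 - (z (Fin.last n) : ℂ) * Complex.I)) - p (Fin.init z))).re) r.domain ∧ Set.EqOn r'.integrand (fun z => -2 * (a (Fin.init z)).im / (1 + z (Fin.last n) ^ 2)) r'.domain ∧ d = Literature.NumberTheory.Transcendental.KZ.of r - Literature.NumberTheory.Transcendental.KZ.of r'})

-- item stmt-KontsevichZagierPeriods-11380 · crux · rank 2 · open · by planner — informal only, no Lean statement yet:
--   [crux] ATTRACTOR CURVE FAMILY (card K1; the load-bearing, unproved geometric statement of the line —
--   a generalised-Hodge-conjecture instance). Setting: Bönisch's fibre-product model (Bonn thesis 2023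
--   §5.1, lit key paper:galaxy-pdf-4515400434874597500, pp. 105–106) of the hypergeometric pencil L = θ⁴
--   − 3⁶z(θ+1/3)²(θ+2/3)²: S_z = {((s:t),(X:Y:Z)) ∈ ℙ¹×ℙ² : sXYZ − t(X³+Y³+zZ³) = 0} (rational elliptic
--   surface, Hesse-type pencil), X_z = S₁ ×_ℙ¹ ε*S_z with ε(s:t) = (t:s), C₃-action φ, V_z = the
--   φ-invariant part of U_z = ker(H³(X_z) → ⊕_{16} H²(ℙ¹)⊗H¹(E₂₇)) (rank 4, Hodge type 1 1 1 1,
--   Picard–Fuchs L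

/-- item stmt-KontsevichZagierPeriods-11361 · crux · rank 3 · open · by planner
why it might fail: uniformity in x needs a ℚ-CAD with continuous semialgebraic sections (not in tree) for the monotonicity cells of |w−p|² and arg(w−p); the signed cancellation is bookkept cell by cell in the free abelian group — one mistyped side condition (Re(w−p)=0 walls) falsifies the ∀.
sources: KontsevichZagier2001, BochnakCosteRoy1998, BasuPollackRoy2006, HuberMullerStach2017
[crux] (E2, the 2πi-carrier; card K2's fibrewise "Cauchy move") over a ℚ-semialgebraic base τ ⊂ ℝⁿ
with semialgebraic centre c(x) ∈ ℂ, radius s(x) > |p(x) − c(x)|, pole p(x) and complex coefficient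
a(x): the (n+1)-dimensional representation [τ × ℝ, Re(a·w′(t)/(w(t) − p))], w = c + s(1+it)/(1−it),
w′ = 2is/(1−it)², is KZ-equivalent to [τ × ℝ, −2·Im a(x)/(1+t²)] (value ∫_τ Re(2πi·a) = −2π∫_τ Im a;
checked numerically, folder num/residue_check.py). Suggested chain: CAD of τ × ℝ; Re(w′/(w−p)) = ∂_t
log|w−p| and Im(w′/(w−p)) = ∂_t arg(w−p) are handled WITHOUT primitives by the substitutions u =
|w−p|² resp. u = Im(w−p)/Re(w−p) on monotonicity cells (rule 2) — the signed image cells cancel (log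
part) or cover ℝ_u exactly twice (arg part, pole inside), so domain additivity alone finishes: a
winding-number instance of LinkTwistWrithe's DegreeTransfer with parameters. [difficulty: L] -/
@[route_item "route-KontsevichZagierPeriods-AttractorUnfolding"]
def FibrewiseResidue : Prop :=
  ∀ (n : ℕ) (τ : Set (Fin n → ℝ)) (c p a : (Fin n → ℝ) → ℂ) (s : (Fin n → ℝ) → ℝ) (r r' : Literature.NumberTheory.Transcendental.KZ.IntegralRep (n + 1)), Literature.ModelTheory.ExponentialFields.IsSemialgebraic ℚ τ → Literature.NumberTheory.Transcendental.IsSemialgebraicFunOn ℚ τ (fun x => (c x).re) → Literature.NumberTheory.Transcendental.IsSemialgebraicFunOn ℚ τ (fun x => (c x).im) → Literature.NumberTheory.Transcendental.IsSemialgebraicFunOn ℚ τ (fun x => (p x).re) → Literature.NumberTheory.Transcendental.IsSemialgebraicFunOn ℚ τ (fun x => (p x).im) → Literature.NumberTheory.Transcendental.IsSemialgebraicFunOn ℚ τ (fun x => (a x).re) → Literature.NumberTheory.Transcendental.IsSemialgebraicFunOn ℚ τ (fun x => (a x).im) → Literature.NumberTheory.Transcendental.IsSemialgebraicFunOn ℚ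 τ s → (∀ x ∈ τ, ‖p x - c x‖ < s x) → r.domain = {z | (Fin.init z : Fin n → ℝ) ∈ τ} → r'.domain = {z | (Fin.init z : Fin n → ℝ) ∈ τ} → Set.EqOn r.integrand (fun z => (a (Fin.init z) * (2 * Complex.I * (s (Fin.init z) : ℂ) / (1 - (z (Fin.last n) : ℂ) * Complex.I) ^ 2) / ((c (Fin.init z) + (s (Fin.init z) : ℂ) * (1 + (z (Fin.last n) : ℂ) * Complex.I) / (1 - (z (Fin.last n) : ℂ) * Complex.I)) - p (Fin.init z))).re) r.domain → Set.EqOn r'.integrand (fun z => -2 * (a (Fin.init z)).im / (1 + z (Fin.last n) ^ 2)) r'.domain → Literature.NumberTheory.Transcendental.KZ.Equivalent r r'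

/-- item stmt-KontsevichZagierPeriods-11362 · crux · rank 4 · open · by planner
why it might fail: the root functions p_j(x) of B(x,·) are semialgebraic only cellwise and collide on walls (multiplicity jumps): partial fractions are not uniformly integrable near a wall where two outside poles merge, forcing a refinement whose finiteness/integrability must be re-proved; degree bound N is essential.
sources: KontsevichZagier2001, BochnakCosteRoy1998, BasuPollackRoy2006
[crux] (E1, Cauchy's theorem with parameters) same circle bundle; g(x, ·) a semialgebraic family of
rational functions of degree ≤ N holomorphic on the closed fibre discs (g = A/B fibrewise, B
zero-free on |w − c(x)| ≤ s(x)); then [τ × ℝ, Re(g(x, w(t))·w′(t))] ∈ KZ.relations (value 0).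
Suggested chain: fibrewise partial fractions over the CAD cells where the poles p_j(x) (all OUTSIDE
the closed disc) are continuous semialgebraic branches (rule 1b); polynomial part and poles of order
≥ 2 have ALGEBRAIC primitives along t (rule 3 on the compactified band, rule 2 t = u/(1−u²)); simple
poles outside = the winding-zero case of FibrewiseResidue's chain. [deps: FibrewiseResidue]
[difficulty: L] -/
@[route_item "route-KontsevichZagierPeriods-AttractorUnfolding"]
def FibrewiseCauchy : Prop :=
  ∀ (n N : ℕ) (τ : Set (Fin n → ℝ)) (c : (Fin n → ℝ) → ℂ) (s : (Fin n → ℝ) → ℝ) (g : (Fin n → ℝ) → ℂ → ℂ) (r : Literature.NumberTheory.Transcendental.KZ.IntegralRep (n + 1)), Literature.ModelTheory.ExponentialFields.IsSemialgebraic ℚ τ → Literature.NumberTheory.Transcendental.IsSemialgebraicFunOn ℚ τ (fun x => (c x).re) → Literature.NumberTheory.Transcendental.IsSemialgebraicFunOn ℚ τ (fun x => (c x).im) → Literature.NumberTheory.Transcendental.IsSemialgebraicFunOn ℚ τ s → (∀ x ∈ τ, 0 < s x) → Literature.NumberTheory.Transcendental.IsSemialgebraicFunOn ℚ {p : Fin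 (n + 2) → ℝ | (Fin.init (Fin.init p) : Fin n → ℝ) ∈ τ ∧ ‖((Fin.init p (Fin.last n) : ℝ) : ℂ) + (p (Fin.last (n + 1)) : ℂ) * Complex.I - c (Fin.init (Fin.init p))‖ ≤ s (Fin.init (Fin.init p))} (fun p => (g (Fin.init (Fin.init p)) ((Fin.init p (Fin.last n) : ℂ) + (p (Fin.last (n + 1)) : ℂ) * Complex.I)).re) → Literature.NumberTheory.Transcendental.IsSemialgebraicFunOn ℚ {p : Fin (n + 2) → ℝ | (Fin.init (Fin.init p) : Fin n → ℝ) ∈ τ ∧ ‖((Fin.init p (Fin.last n) : ℝ) : ℂ) + (p (Fin.last (n + 1)) : ℂ) * Complex.I - c (Fin.init (Fin.init p))‖ ≤ s (Fin.init (Fin.init p))} (fun p => (g (Fin.init (Fin.init p)) ((Fin.init p (Fin.last n) : ℂ) + (p (Fin.last (n + 1)) : ℂ) * Complex.I)).im) → (∀ x ∈ τ, ∃ A B : Polynomial ℂ, A.natDegree ≤ N ∧ B.natDegree ≤ N ∧ ∀ w : ℂ, ‖w - c x‖ ≤ s x → B.eval w ≠ 0 ∧ g x w = A.eval w / B.eval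 w) → r.domain = {z | (Fin.init z : Fin n → ℝ) ∈ τ} → Set.EqOn r.integrand (fun z => (g (Fin.init z) (c (Fin.init z) + (s (Fin.init z) : ℂ) * (1 + (z (Fin.last n) : ℂ) * Complex.I) / (1 - (z (Fin.last n) : ℂ) * Complex.I)) * (2 * Complex.I * (s (Fin.init z) : ℂ) / (1 - (z (Fin.last n) : ℂ) * Complex.I) ^ 2)).re) r.domain → Literature.NumberTheory.Transcendental.KZ.of r ∈ Literature.NumberTheory.Transcendental.KZ.relations

/-- item stmt-KontsevichZagierPeriods-0540 · crux · rank 6 · open · by planner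
why it might fail: A certificate for [π]⋆c may use changes of variables mixing the two disc (tube) coordinates with c's own, leaving no shadow certificate for c; the motivic analogue (effective → 2πi-localised formal periods injective) is open in print; one witness c (item 0542) refutes the summit.
sources: HuberWustholz2022, KontsevichZagier2001, HuberMullerStachPeriods2017, AyoubRelKZRevisited, Ayoub2014
PiCancellation := ∀ c : Literature.NumberTheory.Transcendental.KZ.FormalRep, (of piRep) ⋆ c ∈
Literature.NumberTheory.Transcendental.KZ.relations → c ∈
Literature.NumberTheory.Transcendental.KZ.relations, piRep = closed unit disc with integrand 1 (d =
2). A consequence of S (eval (piRep ⋆ c) = π · eval c by Fubini, π ≠ 0), but transcendence-free: it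
is a regular-element property of the presented abelian group FormalRep/relations under the product,
and the exact point where Ayoub's relative theorem fails to be effective (AyoubRelKZRevisited Rem
1.3: the torsor exists only over D((2πi)⁻¹)) and where HuberMullerStach2017 §13 passes from P^eff to
P = P^eff[(2πi)⁻¹]. Independent of the chosen π-representation once `relations` is an ideal under ⋆
(part of the def request). Attack suggestions: (i) normal forms for ⋆-multiples of disc reps (the
disc factor occupies two leading coordinates untouched by NL along the last coordinate; CoV may mix
them — the crux is whether a relation certificate for piRep ⋆ c can be 'projected' to one for c,
e.g. by restricting/fibrewise-specialising the disc coordinates at a rational point and using domain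
additivity); (ii) small cases: c supported in dimensi -/
@[route_item "route-KontsevichZagierPeriods-AttractorUnfolding"]
def TwistCancellation : Prop :=
  ∀ (P : ∀ n : ℕ, Literature.NumberTheory.Transcendental.KZ.IntegralRep n → Literature.NumberTheory.Transcendental.KZ.IntegralRep (n + 2)), (∀ (n : ℕ) (r : Literature.NumberTheory.Transcendental.KZ.IntegralRep n), (P n r).domain = {z : Fin (n + 2) → ℝ | z 0 ^ 2 + z 1 ^ 2 ≤ 1 ∧ (fun i : Fin n => z i.succ.succ) ∈ r.domain} ∧ (P n r).integrand = fun z => r.integrand (fun i : Fin n => z i.succ.succ)) → ∀ c : Literature.NumberTheory.Transcendental.KZ.FormalRep, FreeAbelianGroup.lift (fun s : (Σ n, Literature.NumberTheory.Transcendental.KZ.IntegralRep n) => Literature.NumberTheory.Transcendental.KZ.of (P s.1 s.2)) c ∈ Literature.NumberTheory.Transcendental.KZ.relations → c ∈ Literature.NumberTheory.Transcendental.KZ.relations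

/-- item stmt-KontsevichZagierPeriods-0541 · crux · rank 7 · open · by planner
why it might fail: Period-conjecture strength once TwistCancellation holds (Ayoub2014 Cor. 32, HMS Prop. 13.2.6: algebraic independence of ζ(3), ζ(5), … follows); torsor methods give relations in Nori's presentation only, and their transfer into the four moves, even with [π] inverted, is unproved.
sources: Ayoub2014, HuberMullerStachPeriods2017, KontsevichZagier2001, arXiv:1105.0865, AyoubRelKZRevisited
PiLocalKernel := ∀ c : Literature.NumberTheory.Transcendental.KZ.FormalRep,
Literature.NumberTheory.Transcendental.KZ.eval c = 0 → ∃ N : ℕ, (of piRep)^⋆N ⋆ c ∈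
Literature.NumberTheory.Transcendental.KZ.relations. This is the half of S reachable by torsor
arguments: Grothendieck's period conjecture gives injectivity of P̃ = P̃^eff[(2πi)⁻¹] → ℂ (route
Grothendieck, 0279), and a transfer of Nori/cohomological relators into KZ.relations (route
NoriTransfer, 0194/0198) then yields (2πi)^{2N}·c = (−4π²)^N·c ∈ relations WITHOUT needing
injectivity of P̃^eff → P̃; Ayoub's rigid-analytic computation of the Betti–de Rham torsor
(Ayoub2015 §3.6, AyoubRelKZRevisited Thm 1.11) is the model argument and works precisely after
inverting 2πi. Open (≈ GPC-strength); filed so that provers/refuters see the effective/localised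
distinction explicitly and so that a proof of #2′ collapses the problem to this item.
[needs_definition: KZ.prodRep / piRep / PiLocalKernel (def request this session); sources:
AyoubRelKZRevisited, Ayoub2015, HuberMullerStach2017] -/
@[route_item "route-KontsevichZagierPeriods-AttractorUnfolding"]
def TwistLocalKernel : Prop :=
  ∀ (P : ∀ n : ℕ, Literature.NumberTheory.Transcendental.KZ.IntegralRep n → Literature.NumberTheory.Transcendental.KZ.IntegralRep (n + 2)), (∀ (n : ℕ) (r : Literature.NumberTheory.Transcendental.KZ.IntegralRep n), (P n r).domain = {z : Fin (n + 2) → ℝ | z 0 ^ 2 + z 1 ^ 2 ≤ 1 ∧ (fun i : Fin n => z i.succ.succ) ∈ r.domain} ∧ (P n r).integrand = fun z => r.integrand (fun i : Fin n => z i.succ.succ)) → ∀ c : Literature.NumberTheory.Transcendental.KZ.FormalRep, Literature.NumberTheory.Transcendental.KZ.eval c = 0 → ∃ N : ℕ, (⇑(FreeAbelianGroup.lift (fun s : (Σ n, Literature.NumberTheory.Transcendental.KZ.IntegralRep n) => Literature.NumberTheory.Transcendental.KZ.of (P s.1 s.2))))^[N] c ∈ Literature.NumberTheory.Transcendental.K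Z.relations

/-- item stmt-KontsevichZagierPeriods-11363 · aside · rank 5 · open · by planner
why it might fail: after partial fractions in μ (denominator μ·Q(x,μ), Q quadratic) the two outside roots of Q(x,·) are algebraic in x and may switch real/complex inside [u₁,u₂] — a wall the statement does not display, forcing an undisplayed base split; a sign slip falsifies exactly (value check passed).
sources: KontsevichZagier2001, Griffiths1969, GriffithsHarris1978, doi:10.2307/1970801
[crux] (calibration rung = the Tate twist of an elliptic arc, card K2 one dimension down) f = X³ +
aX + b over ℚ, f > 0 on [u₁,u₂], upper arc P(x) = (x, √f(x)), complex normal lines L_x = {P(x) +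
μ(−f′(x), 2√f(x))}, ε ∈ ℚ_>0 below the other intersections of L_x with {y² = f}: the 2-dim tube
representation [(u₁,u₂) × ℝ, Im(J·μ′/(Y² − f(X)))] (μ = ε(1+it)/(1−it), (X,Y) = P + μ·n, J the
Jacobian of (x,μ) ↦ (X,Y)) is KZ-equivalent to [(u₁,u₂) × ℝ, 1/(√f(x)(1+t²))]; both have value
π∫dx/√f (residue of dx∧dy/(y²−f) is dx/2y; checked to 1e−6 at a = −1, b = 0, [−0.9,−0.1], ε = 1/100,
folder num/tube_check.py). This is H¹(E)(−1) → H²(𝔸² ∖ E) (tube map) as a chain; one dimension up it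
is the weight-2 block. [deps: FibrewiseCauchy, FibrewiseResidue] [difficulty: M] -/
@[route_item "route-KontsevichZagierPeriods-AttractorUnfolding"]
def EllipticTubeUnfolding : Prop :=
  ∀ (a b u₁ u₂ ε : ℚ) (r r' : Literature.NumberTheory.Transcendental.KZ.IntegralRep 2), u₁ < u₂ → 0 < ε → (∀ x : ℝ, (u₁ : ℝ) ≤ x → x ≤ (u₂ : ℝ) → 0 < x ^ 3 + (a : ℝ) * x + (b : ℝ)) → (∀ x : ℝ, (u₁ : ℝ) ≤ x → x ≤ (u₂ : ℝ) → ∀ μ : ℂ, 0 < ‖μ‖ → ‖μ‖ ≤ (ε : ℝ) → ((Real.sqrt (x ^ 3 + (a : ℝ) * x + (b : ℝ)) : ℂ) + 2 * μ * (Real.sqrt (x ^ 3 + (a : ℝ) * x + (b : ℝ)) : ℂ)) ^ 2 - (((x : ℂ) - μ * (3 * (x : ℂ) ^ 2 + (a : ℂ))) ^ 3 + (a : ℂ) * ((x : ℂ) - μ * (3 * (x : ℂ) ^ 2 + (a : ℂ))) + (b : ℂ)) ≠ 0) → r.domain = {z | (u₁ : ℝ) < z 0 ∧ z 0 < (u₂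 : ℝ)} → r'.domain = {z | (u₁ : ℝ) < z 0 ∧ z 0 < (u₂ : ℝ)} → Set.EqOn r.integrand (fun z => let x : ℝ := z 0; let t : ℝ := z 1; let y : ℝ := Real.sqrt (x ^ 3 + (a : ℝ) * x + (b : ℝ)); let μ : ℂ := (ε : ℂ) * (1 + (t : ℂ) * Complex.I) / (1 - (t : ℂ) * Complex.I); let dμ : ℂ := 2 * Complex.I * (ε : ℂ) / (1 - (t : ℂ) * Complex.I) ^ 2; let X : ℂ := (x : ℂ) - μ * (3 * (x : ℂ) ^ 2 + (a : ℂ)); let Y : ℂ := (y : ℂ) + 2 * μ * (y : ℂ); let dXdx : ℂ := 1 - μ * (6 * (x : ℂ)); let dXdμ : ℂ := -(3 * (x : ℂ) ^ 2 + (a : ℂ)); let dYdx : ℂ := (((3 * x ^ 2 + (a : ℝ)) / (2 * y) : ℝ) : ℂ) * (1 + 2 * μ); let dYdμ : ℂ := 2 * (y : ℂ); ((dXdx * dYdμ - dXdμ * dYdx) * dμ / (Y ^ 2 - (X ^ 3 + (a : ℂ) * X + (b : ℂ)))).im) r.domain → Set.EqOn r'.integrand (fun z => 1 / (Real.sqrt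 (z 0 ^ 3 + (a : ℝ) * z 0 + (b : ℝ)) * (1 + z 1 ^ 2))) r'.domain → Literature.NumberTheory.Transcendental.KZ.Equivalent r r'

-- item stmt-KontsevichZagierPeriods-11381 · support · rank 6 · open · by planner — informal only, no Lean statement yet:
--   [crux] ATTRACTOR WEIGHT-TWO BLOCK AS TYPED CONJECTURE-1 PAIRS (card K3; instance, value-equality
--   NUMERICAL to ten digits — Bönisch thesis pp. 109–110, BKSZ arXiv:2203.09426 §3.3). Notation (thesis
--   §5.1): z* = −1/5832; ϖ = Frobenius basis of L in log(−z) (f₁(0)=1, f₂(0)=f₃(0)=f₄(0)=0; all f_i(z*)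
--   real, convergent with ratio 1/8); Π = M·ϖ with M = diag((2πi)³,(2πi)²,2πi,1) plus the entry −16ζ(3)
--   at (4,1); Θ = z d/dz; g ∈ S₂(Γ₀(54)) the newform with a₅ = 3, ω_g^± defined by r_g((43,−4;54,−5)) =
--   2πi∫_{5/54}^{i∞} g = ω_g⁺ − ω_g⁻ (ω_g⁺ = 1.052362238, ω_g⁻ = 0.8924581010 i). Planner's elimination
--   of

/-- item stmt-KontsevichZagierPeriods-10941 · support · rank 8 · closed · proved by Summit.KontsevichZagierPeriods.KatzTower.discPadding_proof @ 13bc43be04e8 (prover) · by planner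
sources: KontsevichZagier2001, BochnakCosteRoy1998
[support] the pinned product exists: a family P n r : IntegralRep (n+2) with domain {z | z₀² + z₁² ≤
1 ∧ (z₂,…,z_{n+1}) ∈ r.domain} and integrand z ↦ r.integrand (z₂,…,z_{n+1}) — i.e. [π] ⋆ r;
construction = transport of `Literature.NumberTheory.Transcendental.KZ.piRep.prod r : IntegralRep (2
+ n)` along Fin (2+n) ≃ Fin (n+2) (semialgebraicity of domain/integrand by
`IsSemialgebraic.preimage_aeval` under the coordinate relabelling, no Tarski–Seidenberg;
integrability by `KZ.IntegralRep.integrableOn_prodFun` and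
`MeasureTheory.volume_measurePreserving_piCongrLeft`), or directly by Tonelli. Index bookkeeping
only; it makes the ∀-pinned-P cruxes non-vacuous and is a hypothesis of `closes`. [difficulty:
provable-now]; sources: KontsevichZagier2001 §4.1, BCR1998 Prop. 2.2.6 -/
@[route_item "route-KontsevichZagierPeriods-AttractorUnfolding"]
def TwistProductRep : Prop :=
  ∃ (P : ∀ n : ℕ, Literature.NumberTheory.Transcendental.KZ.IntegralRep n → Literature.NumberTheory.Transcendental.KZ.IntegralRep (n + 2)), ∀ (n : ℕ) (r : Literature.NumberTheory.Transcendental.KZ.IntegralRep n), (P n r).domain = {z : Fin (n + 2) → ℝ | z 0 ^ 2 + z 1 ^ 2 ≤ 1 ∧ (fun i : Fin n => z i.succ.succ) ∈ r.domain} ∧ (P n r).integrand = fun z => r.integrand (fun i : Fin n => z i.succ.succ)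

-- `TwistProductRep` holds: proved by `Summit.KontsevichZagierPeriods.KatzTower.discPadding_proof` @ 13bc43be04e8 (its module imports this route file, so no `_holds` link can be stated here).

/-- item stmt-KontsevichZagierPeriods-11364 · support · rank 9 · closed · proved by Summit.KontsevichZagierPeriods.AttractorUnfolding.pointResidue_proof @ 5d7b8accb286 (prover) · by planner
sources: KontsevichZagier2001
[support] the n = 0 case of FibrewiseResidue with algebraic constants c, p, a, s (|p − c| < s): [ℝ,
Re(a·w′/(w − p))] ~ [ℝ, −2·Im a/(1+t²)] — "∮dw/(w−p) = 2πi inside the rules", the first residue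
derivation in the tree; provable now by the two substitutions of FibrewiseResidue without
parameters. [difficulty: provable-now] -/
@[route_item "route-KontsevichZagierPeriods-AttractorUnfolding"]
def PointResidue : Prop :=
  ∀ (c p a : ℂ) (s : ℝ) (r r' : Literature.NumberTheory.Transcendental.KZ.IntegralRep 1), IsAlgebraic ℚ c.re → IsAlgebraic ℚ c.im → IsAlgebraic ℚ p.re → IsAlgebraic ℚ p.im → IsAlgebraic ℚ a.re → IsAlgebraic ℚ a.im → IsAlgebraic ℚ s → ‖p - c‖ < s → r.domain = Set.univ → r'.domain = Set.univ → Set.EqOn r.integrand (fun z => (a * (2 * Complex.I * (s : ℂ) / (1 - (z 0 : ℂ) * Complex.I) ^ 2) / (c + (s : ℂ) * (1 + (z 0 : ℂ) * Complex.I) / (1 - (z 0 : ℂ) * Complex.I) - p)).re) r.domain → Set.EqOn r'.integrand (fun z => -2 * a.im / (1 + z 0 ^ 2)) r'.domain → Literature.NumberTheory.Transcendental.KZ.Equivalent r r'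

-- `PointResidue` holds: proved by `Summit.KontsevichZagierPeriods.AttractorUnfolding.pointResidue_proof` @ 5d7b8accb286 (its module imports this route file, so no `_holds` link can be stated here).

-- item stmt-KontsevichZagierPeriods-11382 · support · rank 9 · open · by planner — informal only, no Lean statement yet:
--   [support] NORMAL-FUNCTION UNFOLDING (card K2 in general form; the derived-move package that turns a
--   cylinder class into a chain). Data: a smooth projective threefold W ⊂ ℙ over ℚ̄ given by equations,
--   an algebraic de Rham class η ∈ F²H³(W) represented in a Zariski-open affine chart by an ambient
--   closed rational form Φ with a pole of order ≤ 2 along W (Griffiths: pole order = Hodge level), a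
--   smooth projective surface Z with a morphism ν : Z → W and a fibration π : Z → B onto a smooth curve
--   B with connected fibres C_b, all over ℚ̄; a real semialgebraic arc (or loop) β ⊂ B avoiding the
--   critical va

/-- item stmt-KontsevichZagierPeriods-14421 · support · rank 9 · closed · proved by Summit.KontsevichZagierPeriods.AttractorUnfolding.residueKernelGlue_proof @ 91f88586dd54 (prover) · by planner
sources: KontsevichZagier2001, Ayoub2014
[support] GLUE — the item that concludes the target (route-choice repair 2026-08-16, option (a) of
the operator hold `route.target-unreachable`): TwistProductRep → TwistCancellation →
TwistLocalKernel → ResidueKernel. PROVED in the planner's folder Sketch.lean (lean check rc 0, 0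
sorries, axioms propext / Classical.choice / Quot.sound; 12 tactic lines, attached as evidence): pin
P; for c with eval c = 0 take N from TwistLocalKernel and peel one [π] at a time with
TwistCancellation (powers are left-nested iterates, `Function.iterate_succ_apply'`, so no
associativity of ⋆ is needed), giving c ∈ KZ.relations, hence c ∈ KZ.relations ⊔ closure(E1-relators
∪ E2-relators) by `AddSubgroup.mem_sup_left` — which is ResidueKernel. With the certified deciding
theorem `closes (h₁ : FibrewiseCauchy) (h₂ : FibrewiseResidue) (h₃ : ResidueKernel)` this completes
the chain cruxes → target → Statement. Honest reading: the twist pair implies the kernel form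
outright, so in LOGIC the engine (E1/E2) is needed in `closes` only to absorb its own relators; its
mathematical role is the dictionary [π]⋆ = tube = contour integral (TubeIsTwist + FibrewiseResidue)
under which the two twist cruxes become statemen -/
@[route_item "route-KontsevichZagierPeriods-AttractorUnfolding"]
def ResidueKernelGlue : Prop :=
  TwistProductRep → TwistCancellation → TwistLocalKernel → ResidueKernel

-- `ResidueKernelGlue` holds: proved by `Summit.KontsevichZagierPeriods.AttractorUnfolding.residueKernelGlue_proof` @ 91f88586dd54 (its module imports this route file, so no `_holds` link can be stated here).

/-- item stmt-KontsevichZagierPeriods-14422 · support · rank 9 · closed · proved by Summit.KontsevichZagierPeriods.AttractorUnfolding.tubeIsTwist_proof @ 055aed9ec054 (prover) · by planner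
sources: KontsevichZagier2001, HuberMullerStachPeriods2017
[support] THE TATE TWIST IS A TUBE (the route's title as a dictionary item; provable, M): for every
pinned product P, every ρ : IntegralRep n and every r' : IntegralRep (n+1) with domain {z | init z ∈
ρ.domain} and integrand ρ(init z)/(1 + z_last²) — the arctangent carrier of FibrewiseResidue /
EllipticTubeUnfolding over ρ — one has [r'] − [P n ρ] ∈ KZ.relations (both values are π·value ρ; n =
0: [ℝ, c/(1+t²)] versus [disc, c]). Chain = KontsevichZagier2001 §1.1's π = ∬_{x²+y²≤1} dxdy =
2∫√(1−u²) du = ∫ du/√(1−u²) = ∫_ℝ dt/(1+t²), run fibrewise with the parameter x ∈ ρ.domain carried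
along: rule 2 with t = u/√(1−u²) on (−1,1) (ℚ-semialgebraic, injective, dt/(1+t²) = du/√(1−u²));
rules 3 + 1b with the primitive ρ(x)·u√(1−u²) (d/du (u√(1−u²)) = 2√(1−u²) − 1/√(1−u²), continuous on
[−1,1], vanishing at u = ±1); rule 3 along a new last coordinate y with primitive y·ρ(x) on the band
−√(1−u²) ≤ y ≤ √(1−u²) (disc bundle with the disc TRAILING); the coordinate permutation to the
pinned P (disc LEADING) is
`Literature.NumberTheory.Transcendental.KZ.of_sub_of_reindex_mem_relations` (proved,
KZProductIdeal.lean); null boundary adjustments ({u = ±1} × …, the circle) by domain additivity ([e]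
∈ -/
@[route_item "route-KontsevichZagierPeriods-AttractorUnfolding"]
def TubeIsTwist : Prop :=
  ∀ (P : ∀ n : ℕ, Literature.NumberTheory.Transcendental.KZ.IntegralRep n → Literature.NumberTheory.Transcendental.KZ.IntegralRep (n + 2)), (∀ (n : ℕ) (r : Literature.NumberTheory.Transcendental.KZ.IntegralRep n), (P n r).domain = {z : Fin (n + 2) → ℝ | z 0 ^ 2 + z 1 ^ 2 ≤ 1 ∧ (fun i : Fin n => z i.succ.succ) ∈ r.domain} ∧ (P n r).integrand = fun z => r.integrand (fun i : Fin n => z i.succ.succ)) → ∀ (n : ℕ) (ρ : Literature.NumberTheory.Transcendental.KZ.IntegralRep n) (r' : Literature.NumberTheory.Transcendental.KZ.IntegralRep (n + 1)), r'.domain = {z | (Fin.init z : Fin n → ℝ) ∈ ρ.domain} → Set.EqOn r'.integrand (fun z => ρ.integrand (Fin.init z) / (1 + z (Fin.last n) ^ 2)) r'.domain → Literature.NumberTheory.Transcendental.KZ.of r' - Literature.NumberTheory.Transcendental.KZ.of (P n ρ) ∈ Literature.NumberTheory.Transcendental.KZ.relations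

-- `TubeIsTwist` holds: proved by `Summit.KontsevichZagierPeriods.AttractorUnfolding.tubeIsTwist_proof` @ 055aed9ec054 (its module imports this route file, so no `_holds` link can be stated here).

/-- item stmt-KontsevichZagierPeriods-11365 · assembly · rank 1 · closed · proved by Summit.KontsevichZagierPeriods.AttractorUnfolding.assembly_proof @ 0075ffca793d (prover) · by planner
sources: KontsevichZagier2001, HuberMullerStach2017
[assembly] FibrewiseCauchy → FibrewiseResidue → ResidueKernel → KontsevichZagierPeriods. -/
@[route_item "route-KontsevichZagierPeriods-AttractorUnfolding"]
def Assembly : Prop :=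
  FibrewiseCauchy → FibrewiseResidue → ResidueKernel → KontsevichZagierPeriods

-- `Assembly` holds: proved by `Summit.KontsevichZagierPeriods.AttractorUnfolding.assembly_proof` @ 0075ffca793d (its module imports this route file, so no `_holds` link can be stated here).

/-! D-0027 §2.1 — DECIDING THEOREM (planner-authored via `route open/edit --closes-file`; by planner-plancard-KontsevichZagierPeriods-Kont-5b6440c9-0 2026-08-15T17:26:15Z):
its hypotheses are this route's items and its conclusion the sub-problem Statement (glue_lint), and it elaborates with this file. -/

@[closes "route-KontsevichZagierPeriods-AttractorUnfolding"] theorem closes (h₁ : FibrewiseCauchy) (h₂ : FibrewiseResidue) (h₃ : ResidueKernel) :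
    KontsevichZagierPeriods := by
  intro n m r r' _ _ hv
  have h0 : Literature.NumberTheory.Transcendental.KZ.eval
      (Literature.NumberTheory.Transcendental.KZ.of r - Literature.NumberTheory.Transcendental.KZ.of r') = 0 := by
    simp [Literature.NumberTheory.Transcendental.KZ.eval_of, hv]
  have hmem := h₃ _ h0
  refine (sup_le le_rfl ((AddSubgroup.closure_le _).mpr ?_)) hmem
  rintro d (hd | hd)
  · obtain ⟨k, N, τ, c, s, g, ρ, hτ, hc1, hc2, hs, hs0, hg1, hg2, hAB, hdom, hint, rfl⟩ := hd
    exact h₁ k N τ c s g ρ hτ hc1 hc2 hs hs0 hg1 hg2 hAB hdom hint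
  · obtain ⟨k, τ, c, p, a, s, ρ, ρ', hτ, hc1, hc2, hp1, hp2, ha1, ha2, hs, hin, hdom, hdom', hint, hint', rfl⟩ := hd
    exact h₂ k τ c p a s ρ ρ' hτ hc1 hc2 hp1 hp2 ha1 ha2 hs hin hdom hdom' hint hint'

end Summit.KontsevichZagierPeriods.KontsevichZagierPeriods.Theses.AttractorUnfolding
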